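import Mathlib

/-!
# Window rigidity on a cusp ray — crux stmt-Schanuel-0969 `RigidCore.MinimalCounterexampleInAcl`

Line `kernel-arithmetic-selection`, stub `stub_windowRigidity`, `--supports stmt-Schanuel-0969`.
`e ≥ 1`, `A ∈ ℂ[X]` of degree `d`, `g` analytic at `0` and not locally constant; `m ≥ 1` is a HIT
when `A(m^{1/e}) + g(m^{-1/e}) ∈ ℤ` (real principal roots).  THEOREM: a window `G ⊆ ℤ` with
`|G| ≥ d + 2` recurs (all `N + j`, `j ∈ G`, are hits) at only finitely many `N`.

PROOF (divided differences).  `n = |G| - 1 ≥ d + 1`, `G = {j₀ < ⋯ < jₙ}`.  The real phase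
`Ψ(κ) = κ^{d/e} Φ₀(κ^{-1/e})`, `Φ₀ = A^{rev} + z^d g`, has `Ψ⁽ᵏ⁾(κ) = κ^{d/e-k} Φ_k(κ^{-1/e})` with
`Φ_{k+1} = (d/e - k) Φ_k - e⁻¹ z Φ_k'` analytic near `0` (`hasDerivAt_chain`).  The MEAN VALUE
THEOREM FOR DIVIDED DIFFERENCES (`exists_divDiff_eq`: Lagrange interpolation, Mathlib
`Lagrange.iterate_derivative_interpolate`, iterated Rolle), applied to `Re Ψ` and `Im Ψ` at the
nodes `N + jᵢ`, gives `n! Σᵢ Ψ(N+jᵢ)/∏_{l≠i}(jᵢ-j_l) = Re Ψ⁽ⁿ⁾(ξ₁) + i Im Ψ⁽ⁿ⁾(ξ₂)`.  At a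
recurrence the left side lies in `(1/Q)ℤ`, `Q = ∏ᵢ∏_{l≠i}(jᵢ-j_l)` (the values are integers,
hence real), while `|Ψ⁽ⁿ⁾(κ)| ≤ C κ^{d/e-n} → 0`; so for large `N` it vanishes:
`Re Φₙ(τ₁) = 0 = Im Φₙ(τ₂)` at real `τ's → 0⁺`.  But with `g - g(0) = z^μ v`, `v(0) ≠ 0`, one has
`Φ_k = P_k + z^{d+μ} v_k` near `0`, `deg P_k ≤ d`, `v_k(0) ≠ 0` (`structure_chain`), hence
`Φₙ ≢ 0` (`not_eventually_zero`), `Φₙ = zᵏ u` with `u(0) ≠ 0`, and `Re u(τ₁) = 0 = Im u(τ₂)`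
contradicts the continuity of `u` at `0`.  Mathlib only; no new definitions. [folklore]
-/

noncomputable section

-- the crux namespace `Summit.Schanuel.Schanuel.…` repeats the summit = problem name by design
set_option linter.dupNamespace false

open Filter Topology Polynomial Finset

namespace Summit.Schanuel.Schanuel.Cruxes.MinimalCounterexampleInAcl.KernelArithmeticSelection

/-- **Mean value theorem for divided differences.**  For a chain `f 0, …, f n` of real functions
(`f (k+1)` the derivative of `f k` on `[t₀, tₙ]`) and increasing nodes `t : Fin (n+1) → ℝ`,
`n! Σᵢ f 0 (tᵢ) / ∏_{j≠i} (tᵢ - tⱼ) = f n ξ` for some `ξ ∈ [t₀, tₙ]` (iterated Rolle for `f 0 - p`,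
`p` the Lagrange interpolant; Mathlib `Lagrange.iterate_derivative_interpolate`). [folklore] -/
theorem exists_divDiff_eq {n : ℕ} (t : Fin (n + 1) → ℝ) (ht : StrictMono t) (f : ℕ → ℝ → ℝ)
    (hder : ∀ k < n, ∀ s ∈ Set.Icc (t 0) (t (Fin.last n)), HasDerivAt (f k) (f (k + 1) s) s) :
    ∃ ξ ∈ Set.Icc (t 0) (t (Fin.last n)),
      (n.factorial : ℝ) * ∑ i, f 0 (t i) / ∏ j ∈ univ.erase i, (t i - t j) = f n ξ := by
  classical
  set p : ℝ[X] := Lagrange.interpolate univ t (fun i => f 0 (t i)) with hp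
  have hinj : Set.InjOn t (univ : Finset (Fin (n + 1))) := ht.injective.injOn
  set r : ℕ → ℝ → ℝ := fun k => f k - fun s => (derivative^[k] p).eval s with hr
  have h1 : ∀ k < n, ∀ s ∈ Set.Icc (t 0) (t (Fin.last n)), HasDerivAt (r k) (r (k + 1) s) s := by
    intro k hk s hs
    have := (hder k hk s hs).sub ((derivative^[k] p).hasDerivAt s)
    simp only [hr, Pi.sub_apply, Function.iterate_succ_apply']
    exact this
  -- iterated Rolle: `r k` vanishes at `m + 1` increasing points of `[t₀, tₙ]` whenever `m + k = n`
  have key : ∀ k m, m + k = n → ∃ s : Fin (m + 1) → ℝ, StrictMono s ∧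
      (∀ i, s i ∈ Set.Icc (t 0) (t (Fin.last n))) ∧ ∀ i, r k (s i) = 0 := by
    intro k
    induction k with
    | zero =>
      intro m hm
      obtain rfl : m = n := by simpa using hm
      refine ⟨t, ht, fun i => ⟨ht.monotone (Fin.zero_le _), ht.monotone (Fin.le_last _)⟩, ?_⟩
      intro i
      have := Lagrange.eval_interpolate_at_node (fun i => f 0 (t i)) hinj (mem_univ i)
      simp only [hr, Function.iterate_zero, id_eq, Pi.sub_apply]
      rw [hp, this, sub_self]
    | succ k ih =>
      intro m hm
      obtain ⟨s, hs, hsI, hsz⟩ := ih (m + 1) (by omega)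
      have hsub : ∀ i : Fin (m + 1),
          Set.Icc (s i.castSucc) (s i.succ) ⊆ Set.Icc (t 0) (t (Fin.last n)) :=
        fun i => Set.Icc_subset_Icc (hsI _).1 (hsI _).2
      have gap : ∀ i : Fin (m + 1), ∃ c ∈ Set.Ioo (s i.castSucc) (s i.succ), r (k + 1) c = 0 :=
        fun i => exists_hasDerivAt_eq_zero (f := r k) (hs i.castSucc_lt_succ)
          (fun x hx => (h1 k (by omega) x (hsub i hx)).continuousAt.continuousWithinAt)
          (by rw [hsz, hsz]) fun x hx => h1 k (by omega) x (hsub i (Set.Ioo_subset_Icc_self hx))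
      choose c hc hcz using gap
      exact ⟨c, fun i j hij => ((hc i).2.trans_le (hs.monotone
        (Fin.succ_le_castSucc_iff.mpr hij))).trans (hc j).1,
        fun i => hsub i (Set.Ioo_subset_Icc_self (hc i)), hcz⟩
  obtain ⟨s, -, hsI, hsz⟩ := key n 0 (by omega)
  refine ⟨s 0, hsI 0, ?_⟩
  have hD := Lagrange.iterate_derivative_interpolate (fun i => f 0 (t i)) hinj
    (show n < #(univ : Finset (Fin (n + 1))) by simp)
  have h0 : f n (s 0) = (derivative^[n] p).eval (s 0) := by
    have := hsz 0
    simp only [hr, Pi.sub_apply] at this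
    exact sub_eq_zero.mp this
  rw [h0, hp, hD]
  simp [eval_finsetSum]

/-- **Structure of the chain near `0`.**  If `Φ 0 = P₀ + z^{d+μ} v₀` near `0` (`deg P₀ ≤ d`,
`v₀` analytic at `0`, `v₀ 0 ≠ 0`, `μ ≥ 1`), every `Φ k` of the chain
`Φ (k+1) = (d/e - k) Φ k - e⁻¹ z (Φ k)'` has the same shape, with
`v_k 0 = ∏_{l<k} (-l - μ/e) v₀ 0 ≠ 0` (`z d/dz` is diagonal on monomials). [folklore] -/
theorem structure_chain {e d μ : ℕ} (he : 0 < e) (hμ : 0 < μ) {Φ : ℕ → ℂ → ℂ}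
    (hsucc : ∀ k z, Φ (k + 1) z =
      ((d : ℂ) * (e : ℂ)⁻¹ - k) * Φ k z - (e : ℂ)⁻¹ * z * deriv (Φ k) z)
    {P₀ : ℂ[X]} (hP₀ : P₀.natDegree ≤ d) {v₀ : ℂ → ℂ} (hv₀ : AnalyticAt ℂ v₀ 0) (hv₀0 : v₀ 0 ≠ 0)
    (h0 : ∀ᶠ z in 𝓝 0, Φ 0 z = P₀.eval z + z ^ (d + μ) * v₀ z) (k : ℕ) :
    ∃ P : ℂ[X], P.natDegree ≤ d ∧ ∃ v : ℂ → ℂ, AnalyticAt ℂ v 0 ∧ v 0 ≠ 0 ∧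
      ∀ᶠ z in 𝓝 0, Φ k z = P.eval z + z ^ (d + μ) * v z := by
  induction k with
  | zero => exact ⟨P₀, hP₀, v₀, hv₀, hv₀0, h0⟩
  | succ k ih =>
    obtain ⟨P, hP, v, hv, hv0, hPv⟩ := ih
    obtain ⟨K, hK⟩ : ∃ K, d + μ = K + 1 := ⟨d + μ - 1, by omega⟩
    refine ⟨C ((d : ℂ) * (e : ℂ)⁻¹ - k) * P - C (e : ℂ)⁻¹ * (X * derivative P), ?_,
      fun z => ((d : ℂ) * (e : ℂ)⁻¹ - k - (e : ℂ)⁻¹ * ((d + μ : ℕ) : ℂ)) * v z -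
        (e : ℂ)⁻¹ * z * deriv v z,
      (analyticAt_const.mul hv).sub ((analyticAt_const.mul analyticAt_id).mul hv.deriv), ?_, ?_⟩
    · rw [natDegree_le_iff_coeff_eq_zero] at hP ⊢
      intro m hm
      obtain ⟨m, rfl⟩ : ∃ m', m = m' + 1 := ⟨m - 1, by omega⟩
      rw [coeff_sub, coeff_C_mul, coeff_C_mul, coeff_X_mul, coeff_derivative, hP _ hm]
      ring
    · have h1 : (d : ℂ) * (e : ℂ)⁻¹ - k - (e : ℂ)⁻¹ * ((d + μ : ℕ) : ℂ) =
          -(((k : ℝ) + (e : ℝ)⁻¹ * μ : ℝ) : ℂ) := by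
        push_cast; ring
      have h2 : (0 : ℝ) < k + (e : ℝ)⁻¹ * μ := by positivity
      simp only [mul_zero, zero_mul, sub_zero, h1]
      exact mul_ne_zero (neg_ne_zero.mpr (by exact_mod_cast h2.ne')) hv0
    · have hder : ∀ᶠ z in 𝓝 (0 : ℂ), deriv (Φ k) z = (derivative P).eval z +
          (((d + μ : ℕ) : ℂ) * z ^ K * v z + z ^ (d + μ) * deriv v z) := by
        filter_upwards [Filter.EventuallyEq.deriv hPv, hv.eventually_analyticAt] with z hz hvz
        have h2 : HasDerivAt (fun z => P.eval z + z ^ (d + μ) * v z) ((derivative P).eval z +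
            (((d + μ : ℕ) : ℂ) * z ^ (d + μ - 1) * v z + z ^ (d + μ) * deriv v z)) z :=
          (P.hasDerivAt z).add ((hasDerivAt_pow (d + μ) z).mul hvz.differentiableAt.hasDerivAt)
        rw [hz, h2.deriv, show d + μ - 1 = K by omega]
      filter_upwards [hPv, hder] with z hz hdz
      rw [hsucc, hdz, hz, hK, pow_succ]
      simp only [eval_sub, eval_mul, eval_C, eval_X]
      push_cast
      ring

/-- A function of the shape `F = P + z^{d+μ} v` near `0` (`deg P ≤ d < d + μ`, `v` continuous at
`0`, `v 0 ≠ 0`) is not identically zero near `0`: else `P = -z^{d+μ} v` on a punctured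
neighbourhood forces `P = 0` (constant terms vanish by letting `z → 0`; divide by `X`; induction)
and then `v 0 = 0` by continuity. [folklore] -/
theorem not_eventually_zero {d μ : ℕ} (hμ : 0 < μ) {F v : ℂ → ℂ} {P : ℂ[X]}
    (hP : P.natDegree ≤ d) (hv : ContinuousAt v 0) (hv0 : v 0 ≠ 0)
    (hF : ∀ᶠ z in 𝓝 0, F z = P.eval z + z ^ (d + μ) * v z) : ¬ ∀ᶠ z in 𝓝 0, F z = 0 := by
  -- a polynomial of degree `< K` equal to `z ^ K * (-v z)` on a punctured neighbourhood is zero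
  have key : ∀ (K : ℕ) (P : ℂ[X]), P.natDegree < K →
      (∀ᶠ z in 𝓝[≠] (0 : ℂ), P.eval z = z ^ K * -v z) → P = 0 := by
    intro K
    induction K with
    | zero => intro P h; omega
    | succ K ih =>
      intro P hdeg hev
      have hlim : Tendsto (fun z : ℂ => z ^ (K + 1) * -v z) (𝓝[≠] 0) (𝓝 0) := by
        have h := ((continuous_pow (K + 1)).continuousAt.tendsto.mul hv.neg.tendsto).mono_left
          (nhdsWithin_le_nhds (s := {(0 : ℂ)}ᶜ) (a := 0))
        simpa using h
      have h0 : P.eval 0 = 0 := tendsto_nhds_unique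
        (((P.continuous.tendsto 0).mono_left nhdsWithin_le_nhds).congr' hev) hlim
      obtain ⟨P₁, rfl⟩ : X ∣ P := X_dvd_iff.mpr (by rwa [coeff_zero_eq_eval_zero])
      by_cases hP₁ : P₁ = 0
      · simp [hP₁]
      rw [natDegree_X_mul hP₁] at hdeg
      rw [ih P₁ (by omega) ?_, mul_zero]
      filter_upwards [hev, self_mem_nhdsWithin] with z hz hz0
      apply mul_left_cancel₀ (show z ≠ 0 from hz0)
      simp only [eval_mul, eval_X] at hz
      rw [hz, pow_succ]
      ring
  intro hF0
  have h1 : ∀ᶠ z in 𝓝 (0 : ℂ), P.eval z = z ^ (d + μ) * -v z := by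
    filter_upwards [hF, hF0] with z hz hz0
    rw [hz0] at hz
    linear_combination -hz
  replace h1 : ∀ᶠ z in 𝓝[≠] (0 : ℂ), P.eval z = z ^ (d + μ) * -v z :=
    h1.filter_mono nhdsWithin_le_nhds
  have hP0 := key (d + μ) P (by omega) h1
  refine hv0 (tendsto_nhds_unique
    ((hv.tendsto.mono_left (nhdsWithin_le_nhds (s := {(0 : ℂ)}ᶜ))).congr' ?_) tendsto_const_nhds)
  filter_upwards [h1, self_mem_nhdsWithin] with z hz hz0
  rw [hP0, eval_zero, eq_comm, mul_eq_zero] at hz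
  exact neg_eq_zero.mp (hz.resolve_left (pow_ne_zero _ hz0))

/-- **Derivative structure on the cusp ray.**  For real `κ > 0`,
`d/dκ [κ^{d/e-k} Φ k (κ^{-1/e})] = κ^{d/e-k-1} Φ (k+1) (κ^{-1/e})`, where
`Φ (k+1) = (d/e - k) Φ k - e⁻¹ z (Φ k)'`, as soon as `Φ k` is complex-differentiable at `κ^{-1/e}`
(Mathlib `Real.hasDerivAt_rpow_const`, `HasDerivAt.scomp`). [folklore] -/
theorem hasDerivAt_chain {e d : ℕ} {Φ : ℕ → ℂ → ℂ}
    (hsucc : ∀ k z, Φ (k + 1) z =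
      ((d : ℂ) * (e : ℂ)⁻¹ - k) * Φ k z - (e : ℂ)⁻¹ * z * deriv (Φ k) z)
    (k : ℕ) {κ : ℝ} (hκ : 0 < κ) (hΦ : DifferentiableAt ℂ (Φ k) ((κ ^ (-(e : ℝ)⁻¹) : ℝ) : ℂ)) :
    HasDerivAt
      (fun x : ℝ => ((x ^ ((d : ℝ) * (e : ℝ)⁻¹ - k) : ℝ) : ℂ) * Φ k ((x ^ (-(e : ℝ)⁻¹) : ℝ) : ℂ))
      (((κ ^ ((d : ℝ) * (e : ℝ)⁻¹ - ((k + 1 : ℕ) : ℝ)) : ℝ) : ℂ) *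
        Φ (k + 1) ((κ ^ (-(e : ℝ)⁻¹) : ℝ) : ℂ)) κ := by
  have h5 := (Real.hasDerivAt_rpow_const (p := (d : ℝ) * (e : ℝ)⁻¹ - k)
    (Or.inl hκ.ne')).ofReal_comp.mul (HasDerivAt.scomp κ hΦ.hasDerivAt
      (Real.hasDerivAt_rpow_const (p := -(e : ℝ)⁻¹) (Or.inl hκ.ne')).ofReal_comp)
  rw [show (d : ℝ) * (e : ℝ)⁻¹ - k - 1 = (d : ℝ) * (e : ℝ)⁻¹ - ((k + 1 : ℕ) : ℝ) by
    push_cast; ring] at h5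
  have r2 : ((κ ^ ((d : ℝ) * (e : ℝ)⁻¹ - k) : ℝ) : ℂ) * ((κ ^ (-(e : ℝ)⁻¹ - 1) : ℝ) : ℂ) =
      ((κ ^ ((d : ℝ) * (e : ℝ)⁻¹ - ((k + 1 : ℕ) : ℝ)) : ℝ) : ℂ) * ((κ ^ (-(e : ℝ)⁻¹) : ℝ) : ℂ) := by
    rw [← Complex.ofReal_mul, ← Complex.ofReal_mul, ← Real.rpow_add hκ, ← Real.rpow_add hκ]
    push_cast
    ring_nf
  have h6 : HasDerivAt (fun x : ℝ => (((x ^ ((d : ℝ) * (e : ℝ)⁻¹ - k) : ℝ) : ℂ)) *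
      Φ k (((x ^ (-(e : ℝ)⁻¹) : ℝ) : ℂ))) _ κ := h5
  refine h6.congr_deriv ?_
  rw [hsucc, smul_eq_mul]
  simp only [Function.comp_apply, Complex.ofReal_mul, Complex.ofReal_neg, Complex.ofReal_sub,
    Complex.ofReal_inv, Complex.ofReal_natCast]
  linear_combination (-(e : ℂ)⁻¹ * deriv (Φ k) (((κ ^ (-(e : ℝ)⁻¹) : ℝ) : ℂ))) * r2

/-- **Stub S4'' — WINDOW RIGIDITY for a cusp ray.**  `A ∈ ℂ[X]`, `g` analytic at `0` and NOT
locally constant, `e ≥ 1`; hits are the `m ≥ 1` with `A(m^{1/e}) + g(m^{-1/e}) ∈ ℤ` (real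
principal roots).  Then every window `G ⊆ ℤ` with `|G| ≥ deg A + 2` recurs at only finitely many
`N`.  Proof: divided differences over the window (see the module docstring). [folklore] -/
theorem stub_windowRigidity : ∀ (e : ℕ) (A : Polynomial ℂ) (g : ℂ → ℂ) (G : Finset ℤ), 0 < e → AnalyticAt ℂ g 0 → (¬ ∀ᶠ z in 𝓝 (0 : ℂ), g z = g 0) → A.natDegree + 2 ≤ G.card → Set.Finite {N : ℕ | ∀ j ∈ G, ∃ m : ℕ, (m : ℤ) = (N : ℤ) + j ∧ 0 < m ∧ ∃ L : ℤ, A.eval ((((m : ℝ) ^ ((e : ℝ)⁻¹) : ℝ) : ℂ)) + g ((((m : ℝ) ^ ((e : ℝ)⁻¹) : ℝ) : ℂ))⁻¹ = L} := by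
  intro e A g G he hg hnc hcard
  by_contra hinf
  set d : ℕ := A.natDegree with hd
  obtain ⟨n, hGn, hdn⟩ : ∃ n : ℕ, G.card = n + 1 ∧ d + 1 ≤ n := ⟨G.card - 1, by omega, by omega⟩
  set σ : Fin (n + 1) ↪o ℤ := G.orderEmbOfFin hGn with hσ
  -- Step 1: `g = g 0 + z ^ μ v` near `0` with `v 0 ≠ 0`, `μ ≥ 1`
  have hga : AnalyticAt ℂ (fun z => g z - g 0) 0 := hg.sub analyticAt_const
  obtain ⟨μ, v, hv, hv0, hgv⟩ := hga.exists_eventuallyEq_pow_smul_nonzero_iff.mpr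
    (by simpa [sub_eq_zero] using hnc)
  simp only [sub_zero, smul_eq_mul, sub_eq_iff_eq_add'] at hgv
  have hμ : 0 < μ := Nat.pos_of_ne_zero fun h => hv0 (by simpa [h] using hgv.self_of_nhds)
  -- Step 2: the analytic chain `Φ`, `Φ 0 = A^{rev} + z ^ d g`
  obtain ⟨Φ, hΦ0, hsucc⟩ : ∃ Φ : ℕ → ℂ → ℂ, (∀ z, Φ 0 z = A.reverse.eval z + z ^ d * g z) ∧
      ∀ k z, Φ (k + 1) z = ((d : ℂ) * (e : ℂ)⁻¹ - k) * Φ k z - (e : ℂ)⁻¹ * z * deriv (Φ k) z :=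
    ⟨fun k => @Nat.rec (fun _ => ℂ → ℂ) (fun z => A.reverse.eval z + z ^ d * g z)
      (fun k Φk z => ((d : ℂ) * (e : ℂ)⁻¹ - k) * Φk z - (e : ℂ)⁻¹ * z * deriv Φk z) k,
      fun z => rfl, fun k z => rfl⟩
  obtain ⟨ρ, hρ, hgρ⟩ := hg.exists_ball_analyticOnNhd
  have hΦan : ∀ k, AnalyticOnNhd ℂ (Φ k) (Metric.ball 0 ρ) := by
    intro k
    induction k with
    | zero =>
      intro z hz
      rw [show Φ 0 = fun z => A.reverse.eval z + z ^ d * g z from funext hΦ0]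
      exact (A.reverse.differentiable.analyticAt z).add ((analyticAt_id.pow d).mul (hgρ z hz))
    | succ k ih =>
      rw [show Φ (k + 1) = _ from funext (hsucc k)]
      exact (analyticOnNhd_const.mul ih).sub
        ((analyticOnNhd_const.mul analyticOnNhd_id).mul ih.deriv)
  -- Step 3: structure near `0`; `Φ n = z ^ k0 • u` with `u 0 ≠ 0`
  have hP0 : (A.reverse + C (g 0) * X ^ d).natDegree ≤ d :=
    (natDegree_add_le _ _).trans (max_le A.reverse_natDegree_le (natDegree_C_mul_X_pow_le _ _))
  obtain ⟨Pn, hPn, w, hw, hw0, hPw⟩ := structure_chain he hμ hsucc hP0 hv hv0 (by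
    filter_upwards [hgv] with z hz
    rw [hΦ0, hz]
    simp only [eval_add, eval_mul, eval_C, eval_pow, eval_X]
    ring) n
  have hΦn0 : AnalyticAt ℂ (Φ n) 0 := hΦan n 0 (Metric.mem_ball_self hρ)
  obtain ⟨k0, u, hu, hu0, hFu⟩ := hΦn0.exists_eventuallyEq_pow_smul_nonzero_iff.mpr
    (not_eventually_zero hμ hPn hw.continuousAt hw0 hPw)
  -- Step 4: the integer weights of the window
  set wt : Fin (n + 1) → ℤ := fun i => ∏ j ∈ univ.erase i, (σ i - σ j) with hwt
  have hwt0 : ∀ i, wt i ≠ 0 := fun i => prod_ne_zero_iff.mpr fun j hj =>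
    sub_ne_zero.mpr fun h => (mem_erase.mp hj).1 (σ.injective h).symm
  set Q : ℤ := ∏ i, wt i with hQ
  have hQ0 : Q ≠ 0 := prod_ne_zero_iff.mpr fun i _ => hwt0 i
  -- Step 5: thresholds, eventually as `κ → ∞` (`τ κ = κ^{-1/e} → 0`)
  set τ : ℝ → ℂ := fun κ => ((κ ^ (-(e : ℝ)⁻¹) : ℝ) : ℂ) with hτ
  have hτ0 : Tendsto τ atTop (𝓝 0) := by
    have h := (Complex.continuous_ofReal.tendsto 0).comp
      (tendsto_rpow_neg_atTop (y := (e : ℝ)⁻¹) (by positivity))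
    rw [Complex.ofReal_zero] at h
    exact h
  have hu00 : 0 < ‖u 0‖ := norm_pos_iff.mpr hu0
  have hA : ∀ᶠ z in 𝓝 (0 : ℂ), Φ n z = z ^ k0 * u z ∧ ‖u z - u 0‖ < ‖u 0‖ / 2 := by
    filter_upwards [hFu, Metric.tendsto_nhds.mp hu.continuousAt.tendsto _ (half_pos hu00)]
      with z h1 h2
    exact ⟨by simpa only [sub_zero, smul_eq_mul] using h1, by rwa [← dist_eq_norm]⟩
  have hB : ∀ᶠ z in 𝓝 (0 : ℂ), ‖Φ n z - Φ n 0‖ < 1 := by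
    filter_upwards [Metric.tendsto_nhds.mp hΦn0.continuousAt.tendsto 1 one_pos] with z h
    rwa [← dist_eq_norm]
  have hC : ∀ᶠ κ : ℝ in atTop,
      |(Q : ℝ)| * (κ ^ ((d : ℝ) * (e : ℝ)⁻¹ - n) * (‖Φ n 0‖ + 1)) < n.factorial := by
    have h1 : Tendsto (fun κ : ℝ => κ ^ ((d : ℝ) * (e : ℝ)⁻¹ - n)) atTop (𝓝 0) := by
      rw [show (d : ℝ) * (e : ℝ)⁻¹ - n = -((n : ℝ) - (d : ℝ) * (e : ℝ)⁻¹) by ring]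
      refine tendsto_rpow_neg_atTop ?_
      have h3 : (d : ℝ) * (e : ℝ)⁻¹ ≤ d :=
        mul_le_of_le_one_right d.cast_nonneg (inv_le_one_of_one_le₀ (by exact_mod_cast he))
      have h4 : (d : ℝ) + 1 ≤ n := by exact_mod_cast hdn
      linarith
    have h2 := (h1.mul_const (‖Φ n 0‖ + 1)).const_mul |(Q : ℝ)|
    rw [zero_mul, mul_zero] at h2
    exact h2.eventually (gt_mem_nhds (by positivity))
  obtain ⟨K, hK⟩ := eventually_atTop.mp ((eventually_ge_atTop 1).and <|
    (hτ0.eventually (Metric.ball_mem_nhds 0 hρ)).and <| (hτ0.eventually hA).and <|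
    (hτ0.eventually hB).and hC)
  -- Step 6: a large recurrence `N`, the nodes `t i = N + jᵢ` and the phase `M k`
  obtain ⟨N, hNR, hNgt⟩ := Set.Infinite.exists_gt hinf ⌈K - (σ 0 : ℝ)⌉₊
  set t : Fin (n + 1) → ℝ := fun i => (N : ℝ) + σ i with ht
  have htm : StrictMono t := fun i j hij => by
    have : (σ i : ℝ) < σ j := by exact_mod_cast σ.strictMono hij
    simp only [ht]
    linarith
  have htK : ∀ s ∈ Set.Icc (t 0) (t (Fin.last n)), K ≤ s := fun s hs => by
    have h1 := Nat.le_ceil (K - (σ 0 : ℝ))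
    have h2 : (⌈K - (σ 0 : ℝ)⌉₊ : ℝ) < N := by exact_mod_cast hNgt
    have h3 : (N : ℝ) + σ 0 ≤ s := hs.1
    linarith
  set M : ℕ → ℝ → ℂ := fun k x => ((x ^ ((d : ℝ) * (e : ℝ)⁻¹ - k) : ℝ) : ℂ) * Φ k (τ x)
    with hM
  -- Step 7: at the nodes the phase takes the integer hit values
  have hhit : ∀ i, ∃ L : ℤ, M 0 (t i) = L := by
    intro i
    obtain ⟨m, hm, hmpos, L, hL⟩ := hNR (σ i) (G.orderEmbOfFin_mem hGn i)
    have hmR : (m : ℝ) = t i := by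
      have h1 := congrArg (Int.cast : ℤ → ℝ) hm
      push_cast at h1
      simpa [ht] using h1
    refine ⟨L, ?_⟩
    rw [← hmR, ← hL]
    have hm0 : (0 : ℝ) < m := by exact_mod_cast hmpos
    set y : ℝ := (m : ℝ) ^ (e : ℝ)⁻¹ with hy
    have hy0 : (y : ℂ) ≠ 0 := by exact_mod_cast (Real.rpow_pos_of_pos hm0 _).ne'
    have key : A.reverse.eval (y : ℂ)⁻¹ * (y : ℂ) ^ d = A.eval (y : ℂ) := by
      letI : Invertible (y : ℂ) := invertibleOfNonzero hy0
      rw [← invOf_eq_inv]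
      exact eval₂_reverse_mul_pow (RingHom.id ℂ) (y : ℂ) A
    have h1 : (m : ℝ) ^ ((d : ℝ) * (e : ℝ)⁻¹ - ((0 : ℕ) : ℝ)) = y ^ d := by
      rw [Nat.cast_zero, sub_zero, mul_comm, Real.rpow_mul hm0.le, Real.rpow_natCast]
    simp only [hM, hτ, h1, Real.rpow_neg hm0.le, ← hy, hΦ0]
    push_cast
    rw [mul_add, ← mul_assoc, ← mul_pow, mul_inv_cancel₀ hy0, one_pow, one_mul, mul_comm, key]
  choose L hL using hhit
  -- Step 8: derivative chains for `s ≥ K`; mean value theorem for real and imaginary parts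
  have hderM : ∀ k s, K ≤ s → HasDerivAt (M k) (M (k + 1) s) s := fun k s hs =>
    hasDerivAt_chain hsucc k (by linarith [(hK s hs).1]) (hΦan k _ (hK s hs).2.1).differentiableAt
  obtain ⟨ξ₁, hξ₁, hre⟩ := exists_divDiff_eq t htm (fun k s => (M k s).re) fun k _ s hs =>
    Complex.reCLM.hasFDerivAt.comp_hasDerivAt s (hderM k s (htK s hs))
  obtain ⟨ξ₂, hξ₂, him⟩ := exists_divDiff_eq t htm (fun k s => (M k s).im) fun k _ s hs =>
    Complex.imCLM.hasFDerivAt.comp_hasDerivAt s (hderM k s (htK s hs))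
  have hK1 := hK ξ₁ (htK ξ₁ hξ₁)
  have hK2 := hK ξ₂ (htK ξ₂ hξ₂)
  have htd : ∀ i, ∏ j ∈ univ.erase i, (t i - t j) = (wt i : ℝ) := fun i => by
    simp only [ht, hwt]
    push_cast
    exact prod_congr rfl fun j _ => by ring
  have him0 : (M n ξ₂).im = 0 := by rw [← him]; simp [hL]
  have hre' : (n.factorial : ℝ) * ∑ i, (L i : ℝ) / (wt i : ℝ) = (M n ξ₁).re := by
    rw [← hre]; simp [hL, htd]
  -- Step 9: integrality: `Q Σ L i / wt i ∈ ℤ`, and `|n! Q Σ L i / wt i| ≤ |Q| ‖M n ξ₁‖ < n!`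
  set Z : ℤ := ∑ i, L i * ∏ j ∈ univ.erase i, wt j with hZ
  have hQZ : (Q : ℝ) * ∑ i, (L i : ℝ) / (wt i : ℝ) = Z := by
    rw [hZ, mul_sum]
    push_cast
    refine sum_congr rfl fun i _ => ?_
    have hwi : (wt i : ℝ) ≠ 0 := by exact_mod_cast hwt0 i
    rw [hQ, ← mul_prod_erase univ wt (mem_univ i)]
    push_cast
    field_simp
  have hξ0 : (0 : ℝ) < ξ₁ := by linarith [hK1.1]
  have hMn : ‖M n ξ₁‖ ≤ ξ₁ ^ ((d : ℝ) * (e : ℝ)⁻¹ - n) * (‖Φ n 0‖ + 1) := by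
    have h1 : ‖Φ n (τ ξ₁)‖ ≤ ‖Φ n 0‖ + 1 := by
      linarith [norm_sub_norm_le (Φ n (τ ξ₁)) (Φ n 0), hK1.2.2.2.1]
    simp only [hM, norm_mul, Complex.norm_real, Real.norm_eq_abs,
      abs_of_pos (Real.rpow_pos_of_pos hξ0 _)]
    exact mul_le_mul_of_nonneg_left h1 (Real.rpow_pos_of_pos hξ0 _).le
  have hZ0 : Z = 0 := by
    have h1 : ((n.factorial : ℝ)) * Z = Q * (M n ξ₁).re := by rw [← hre', ← hQZ]; ring
    have h2 : (n.factorial : ℝ) * |(Z : ℝ)| < n.factorial * 1 := by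
      rw [← Nat.abs_cast n.factorial, ← abs_mul, h1, abs_mul, Nat.abs_cast, mul_one]
      calc |(Q : ℝ)| * |(M n ξ₁).re| ≤ |(Q : ℝ)| * (ξ₁ ^ ((d : ℝ) * (e : ℝ)⁻¹ - n) *
          (‖Φ n 0‖ + 1)) := by gcongr; exact (Complex.abs_re_le_norm _).trans hMn
        _ < n.factorial := hK1.2.2.2.2
    have h3 : |(Z : ℝ)| < 1 := lt_of_mul_lt_mul_left h2 (by positivity)
    exact Int.abs_lt_one_iff.mp (by exact_mod_cast h3)
  have hre0 : (M n ξ₁).re = 0 := by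
    have h1 : ∑ i, (L i : ℝ) / (wt i : ℝ) = 0 := by
      rw [hZ0, Int.cast_zero, mul_eq_zero] at hQZ
      exact hQZ.resolve_left (by exact_mod_cast hQ0)
    rw [← hre', h1, mul_zero]
  -- Step 10: `M n ξ = c • u (τ ξ)` with `c > 0`, so `Re u (τ ξ₁) = 0 = Im u (τ ξ₂)`: contradiction
  have hfac : ∀ s, K ≤ s → ∃ c : ℝ, 0 < c ∧ M n s = c * u (τ s) := fun s hs => by
    have hs0 : 0 < s := by linarith [(hK s hs).1]
    refine ⟨s ^ ((d : ℝ) * (e : ℝ)⁻¹ - n) * (s ^ (-(e : ℝ)⁻¹)) ^ k0,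
      mul_pos (Real.rpow_pos_of_pos hs0 _) (pow_pos (Real.rpow_pos_of_pos hs0 _) _), ?_⟩
    simp only [hM]
    rw [(hK s hs).2.2.1.1]
    simp only [hτ]
    push_cast
    ring
  obtain ⟨c₁, hc₁, hM₁⟩ := hfac ξ₁ (htK ξ₁ hξ₁)
  obtain ⟨c₂, hc₂, hM₂⟩ := hfac ξ₂ (htK ξ₂ hξ₂)
  rw [hM₁, Complex.re_ofReal_mul, mul_eq_zero] at hre0
  rw [hM₂, Complex.im_ofReal_mul, mul_eq_zero] at him0
  have h1 := Complex.abs_re_le_norm (u (τ ξ₁) - u 0)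
  have h2 := Complex.abs_im_le_norm (u (τ ξ₂) - u 0)
  rw [Complex.sub_re, hre0.resolve_left hc₁.ne', zero_sub, abs_neg] at h1
  rw [Complex.sub_im, him0.resolve_left hc₂.ne', zero_sub, abs_neg] at h2
  linarith [Complex.norm_le_abs_re_add_abs_im (u 0), hK1.2.2.1.2, hK2.2.2.1.2]

end Summit.Schanuel.Schanuel.Cruxes.MinimalCounterexampleInAcl.KernelArithmeticSelection

end
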